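import Summits.QuantumFields.YangMills.Theorems.BalabanUVNodesN16HolderMSOfThm4Output
import Summits.QuantumFields.YangMills.Theorems.BalabanUVNodesN16HolderMSTorusOfZd
import Summits.QuantumFields.YangMills.Theorems.BalabanUVNodesN16HolderMSOfLeaf
import Summits.QuantumFields.YangMills.Theorems.BalabanUVNodesN16OfLeafRS
import HarnessLib

/-!
# Route «BalabanUVNodes», cluster K4 «SpineRates» — node N16 = NE3: ★ THE N05 → N16 EDGE WITH THE (1.36)₃ MEMBER MULTI-SCALE, END TO END — node N05's leaf of
# record SHAPE on `zdGF3 (M_n ℂ) L β len` at ANY `β ∈ [0, 1]` + N07's (H3ˢᵘᵖ) + the length letter ⟹ the MULTI-SCALE β-root `CovRootHolderMS` (repair R-β″,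
# PRODUCER HALF, (R7) part 2; twin of generation 3's file 14 `N16HolderOfLeaf`)

Cell `pub-ymgap`, seat `pub-ymgap-dag-n16-c` (R134 fan-out seat, strategy s1; HUMAN RULING D-0062; chair R424 venue), generation 4, file 36 — over files 35
(`N16HolderMSOfThm4Output` §4), 32 (`N16HolderMSTorusOfZd.thm4TorusAt_printMS_of_zd`), 34 (`N16HolderMSOfLeaf.thm4TorusAt_printMS_of_leaf`) and g0's `OfLeaf`
(`exists_window_print`) ∕ `OfLeafRS` (leaf unpacking).  `--supports stmt-QuantumFields-19912 --as helper` (K3‴ `SpineGivenEndpointR13`, route rev 16).  `bears_on: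
R4∕N16 · edge N05 → N16`.  Located item: `HOME/pub-ymgap-dag-n16-c/LOCATED-N16-HOLDER-PIN.md`, census row R-β″ (ADDENDUM 5).

WHY.  This closes repair R-β″ on the producer side: generation 3's `n16_holder_of_b8LeafRS` (the N05 → N16 edge at a generic Hölder exponent, nearest-neighbour
reading) becomes `n16_holderMS_of_b8LeafRS` — the same leaf hypotheses (`B8LeafRS` with only `t4`, `p3` read) give the MULTI-SCALE β-root, because node N05's
Proposition-3 body already bounds the (3.40) quotient at every admissible pair (file 33).  Two letter changes against generation 3: the length letter
`∀ μ j, len (j•e_μ) = j` (print's |·| on ηℤᵈ) in place of `len e_μ = 1`, and the Hölder threshold `B_h·s + 10·α_{b′}·B·s ≤ s₂` (the ladder's `2α_{b′}g′`, bricks 1 ∕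
file 29) in place of `… + 8·α_{b′}·B·s ≤ s₂`.  With the consumer half (files 20–22) the window-free Hölder road is typed from node N05's leaf to NE7's four
closeness coordinates at rate `(θ^k)^{(12+14β)∕(1+β)}`, below the plaquette margin for EVERY `β ∈ (0, 1]`.

WHAT THIS FILE PROVES (kernel, theorems only, 0 `def`, 0 sorry): §1 `n16_holderMS_of_thm4Zd_printMS`; §2 `n16_holderMS_of_leaf`; §3 ★ `n16_holderMS_of_b8LeafRS`.
HONEST FRAMING: binder bookkeeping over LANDED theorems by name; the leaf (`B8LeafRS` on `zdGF3`: [Balaban1985RegularSpaces] Thm 4 ∕ Prop 3 at curved backgrounds)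
is node N05's theorem — in the tree only modulo its sockets — and (H3ˢᵘᵖ) is N07's [Balaban1985Variational] Thm 1 (8)+(10) TYPE; N16 ∕ NE3 NOT discharged;
count-neutral; one finite four-torus at fixed ε — NOT ℝ⁴, NOT infinite volume, NOT OS, NOT a mass gap, NOT Clay.
-/

set_option autoImplicit false

open scoped BigOperators Matrix Matrix.Norms.L2Operator
open NormedSpace

namespace Summit.QuantumFields.YangMills.BalabanUVNodes.N16HolderMSOfLeafTop

open Literature.MathematicalPhysics.QuantumFieldTheory.Balaban1983to89
open B7Prop1Explicit B7Prop2Explicit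
open B7Prop3Flat (c3)
open T4AveragingDeficitWall (Ad)
open B7Eq92Concrete (mgauge)
open B8Ineq132 (covDerivFwd InAk)
open B8Eq184Proof (cfgExp)
open B8Eq119TwistedAxial (Restr129)
open B8Eq133Hypotheses (Reg335Zd)
open B8Eq138LandauZd (covLap IsLandau138)
open B8Thm4TorusAt (torusLam Thm4TorusAt)
open B8LeafModelZd (ZdIdx)
open B8LeafModelZd3 (zdGF3)
open B8LeafKnitRS (B8LeafRS)
open Summit.QuantumFields.BalabanUV.T4Continuum
open BlockAverageCurrent (curConst)
open NE3RightInverseSupLetters (frameC)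
open NE3.LeafIndexSockets (LeafH3sup)
open MinimalActionRate (sfClass)
open Summit.QuantumFields.YangMills.BalabanUVNodes.N16HolderMSDefs (CovRootHolderMS)
open Summit.QuantumFields.YangMills.BalabanUVNodes.N16HolderMSOfThm4Output (n16_holderMS_of_thm4TorusAt_printMS)
open Summit.QuantumFields.YangMills.BalabanUVNodes.N16HolderMSTorusOfZd (thm4TorusAt_printMS_of_zd)
open Summit.QuantumFields.YangMills.BalabanUVNodes.N16.OfLeaf (exists_window_print)
open Summit.QuantumFields.YangMills.BalabanUVNodes.N16HolderMSOfLeaf (thm4TorusAt_printMS_of_leaf)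

noncomputable section

/-! ## §1 The `ℤᵈ` reading of Theorem 4 at exponent `β ≤ 1` -/

section Knit

variable {n : Type*} [Fintype n] [DecidableEq n]

/-- **N16 · THE β-ROOT FROM THE `ℤᵈ` READING OF [B8] THEOREM 4 AT THE ALL-TORUS MEMBER (HÖLDER MEMBER AT EXPONENT `β ≤ 1`) AND N07's INTERFACE** (`d = 4`;
`L ≥ 2`, `N ≥ 1`) — generation 0's `N16.n16_of_thm4Zd_print` with `1 ↦ β`: file 13's `n16_holder_of_thm4TorusAt_print` with (T4ᵀ_print)_β REPLACED by
(T4^ℤᵈ_print)_β `∀ k ≥ 1, Thm4TorusAt L k 0 (Lᵏ)⁻¹ c₁ unitaryUnits (Reg335Zd (Lᵏ)⁻¹ L (𝒬 k) C₃₃₅) (Restr129 L k (torusLam k)) Concl⁰_print(B, B_h; β)` (no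
periodicity anywhere; uniqueness among all unitary gauges) plus the letter lines `0 ≤ B`, `16·B·c₁ ≤ 1`; conclusion `CovRootHolderMS 4 (sfClass 4 L N ε) L N b g C
s₁ s₂ β dom`.  `N16.thm4TorusAt_print_of_zd` (the periodicity principle, β-generic) ∘ file 13 §4.  N16 ∕ NE3 NOT proved: (T4^ℤᵈ_print)_β is node N05's theorem
([Balaban1985RegularSpaces] Thm 4 + Prop 3 at curved backgrounds, Hölder member as printed), (H3ˢᵘᵖ) is N07's. [folklore] -/
theorem n16_holderMS_of_thm4Zd_printMS [Nonempty n] {L N : ℕ} (hL : 2 ≤ L) (hN : 1 ≤ N) :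
    ∃ r : ℝ, 0 < r ∧ ∀ ⦃g : ℝ⦄, 0 < g → ∃ C : ℝ, 0 ≤ C ∧ ∀ (c₁ B Bh : ℝ), 0 ≤ B → 16 * (B * c₁) ≤ 1 → ∀ ⦃b' c' : ℝ⦄, 0 ≤ b' → 0 ≤ c' →
      2 ^ 15 * ((4 : ℝ) + 1) ^ 2 * ((4 : ℝ) + 4) ^ 2 * (L : ℝ) ^ 2 * b' ≤ 1 →
      23040 * (4 : ℝ) ^ 4 * (frameC 4 L + 4) ^ 3 * (c' + curConst 4 L * b' ^ 2) ≤ 1 →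
      ∀ ⦃α : ℝ⦄, 0 < α → C0 4 * α ≤ 1 / 3 → 2 * α ≤ c2' 4 L → 11 * (4 : ℝ) ^ 2 * α ≤ 1 / 6 → α + 11 * (4 : ℝ) ^ 2 * α ≤ c₁ →
      b' + 226 * (8 * ((4 : ℝ) + 1) * ((4 : ℝ) + 4)) ^ 2 * b' ^ 2 < α → 4 * ((4 : ℝ) - 1) * (c' + curConst 4 L * b' ^ 2) < α →
      ∀ ⦃Mc : ℝ⦄, 0 ≤ Mc → (Mc + 1) * (b' + 226 * (8 * ((4 : ℝ) + 1) * ((4 : ℝ) + 4)) ^ 2 * b' ^ 2) ≤ 1 / 2 →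
      ∀ (𝒬 : ℕ → Set (Set (Site 4) × ℕ)), (∀ k, ∀ q ∈ 𝒬 k, q.2 ≤ k ∧ ∃ y : Site 4, ∀ z ∈ q.1, (l1 (z - y) : ℝ) ≤ Mc * (L : ℝ) ^ q.2) →
      ∀ ⦃C335 : ℝ⦄, 2 * (Mc + 1) * (b' + 226 * (8 * ((4 : ℝ) + 1) * ((4 : ℝ) + 4)) ^ 2 * b' ^ 2) + 2 * Mc * (2 * (c' + curConst 4 L * b' ^ 2)) +
        4 * Mc * (1 + 2 * Mc) * (b' + 226 * (8 * ((4 : ℝ) + 1) * ((4 : ℝ) + 4)) ^ 2 * b' ^ 2) ^ 2 < C335 →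
      ∀ ⦃ε s₁ b s₂ : ℝ⦄, 0 < ε → ε ≤ r → ε < α → 0 ≤ s₁ → s₁ ≤ r → 0 ≤ b → b ≤ ε / 2 →
      B * (α + 11 * (4 : ℝ) ^ 2 * α) ≤ s₁ →
      B * (α + 11 * (4 : ℝ) ^ 2 * α) + 2 * (b' + 226 * (8 * ((4 : ℝ) + 1) * ((4 : ℝ) + 4)) ^ 2 * b' ^ 2) * s₁ ≤ s₁ →
      B * (α + 11 * (4 : ℝ) ^ 2 * α) + 16 * (b' + 226 * (8 * ((4 : ℝ) + 1) * ((4 : ℝ) + 4)) ^ 2 * b' ^ 2) * (B * (α + 11 * (4 : ℝ) ^ 2 * α)) ≤ s₁ →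
      Bh * (α + 11 * (4 : ℝ) ^ 2 * α) + 10 * (b' + 226 * (8 * ((4 : ℝ) + 1) * ((4 : ℝ) + 4)) ^ 2 * b' ^ 2) * (B * (α + 11 * (4 : ℝ) ^ 2 * α)) ≤ s₂ → ∀ ⦃β : ℝ⦄, 0 ≤ β → β ≤ 1 →
      (∀ k, 1 ≤ k → Thm4TorusAt L k 0 (((L : ℝ) ^ k)⁻¹) c₁ (unitaryUnits (Matrix n n ℂ))
        (Reg335Zd (((L : ℝ) ^ k)⁻¹) L (𝒬 k) C335) (Restr129 L k (torusLam k))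
        (fun (α₀ α₁ : ℝ) (U₀ U' : Site 4 → Fin 4 → (Matrix n n ℂ)ˣ) (u : Site 4 → (Matrix n n ℂ)ˣ) =>
          ∃ A : Site 4 → Fin 4 → Matrix n n ℂ,
            (∀ x μ, IsSelfAdjoint (A x μ)) ∧ mgauge U₀ u (cfgExp (((L : ℝ) ^ k)⁻¹) A) = U' ∧
            (∀ x μ, ‖A x μ‖ ≤ B * (α₀ + α₁)) ∧
            (∀ (μ : Fin 4) (x : Site 4) (κ : Fin 4), ‖covDerivFwd (((L : ℝ) ^ k)⁻¹) U₀ μ (fun z => A z κ) x‖ ≤ B * (α₀ + α₁)) ∧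
            IsLandau138 L k (((L : ℝ) ^ k)⁻¹) Set.univ (torusLam k) U₀ A ∧
            (∀ (κ μ : Fin 4) (y : Site 4) (j : ℕ), 1 ≤ j → j ≤ L ^ k →
              ‖Ad (hol U₀ y (seg μ (j : ℤ))) (covDerivFwd (((L : ℝ) ^ k)⁻¹) U₀ μ (fun z => A z κ) (y + j • e μ))
                  - covDerivFwd (((L : ℝ) ^ k)⁻¹) U₀ μ (fun z => A z κ) y‖
                ≤ Bh * (α₀ + α₁) * ((((L : ℝ)⁻¹) ^ k) ^ β * (j : ℝ) ^ β)) ∧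
            (∀ (x : Site 4) (κ : Fin 4), ‖covLap (((L : ℝ) ^ k)⁻¹) U₀ (fun z => A z κ) x‖ ≤ B * (α₀ + α₁)))) →
      ∀ {dom : _root_.Set (Site 4 → Fin 4 → (Matrix n n ℂ)ˣ)},
        LeafH3sup 4 L N ε b' c' dom →
        CovRootHolderMS 4 (sfClass 4 L N ε) L N b g C s₁ s₂ β dom := by
  have hL1 : 1 ≤ L := by omega
  obtain ⟨r, hr0, hr⟩ := n16_holderMS_of_thm4TorusAt_printMS (n := n) hL hN
  refine ⟨r, hr0, fun g hg => ?_⟩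
  obtain ⟨C, hC0, hC⟩ := hr hg
  refine ⟨C, hC0, fun c₁ B Bh hB hBc b' c' hb' hc' hRb hcF α hα hA3 hA2 hAs hAc hb'α hc'α Mc hMc hMcα 𝒬 h𝒬 C335 hC335 ε s₁ b s₂
    hε hεr hεα hs₁ hs₁r hb hbh hss hgrad hℓ hhol β hβ0 hβ hT0 dom h3 => ?_⟩
  have hηk : ∀ k : ℕ, 0 < ((L : ℝ) ^ k)⁻¹ ∧ ((L : ℝ) ^ k)⁻¹ ≤ 1 := fun k => by
    have hL1r : (1 : ℝ) ≤ L := by exact_mod_cast hL1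
    have hLk : (1 : ℝ) ≤ (L : ℝ) ^ k := one_le_pow₀ hL1r
    exact ⟨by positivity, inv_le_one_of_one_le₀ hLk⟩
  exact hC c₁ B Bh hb' hc' hRb hcF hα hA3 hA2 hAs hAc hb'α hc'α hMc hMcα 𝒬 h𝒬 hC335 hε hεr hεα hs₁ hs₁r hb hbh hss hgrad hℓ hhol hβ0 hβ
    (fun k hk => thm4TorusAt_printMS_of_zd hL1 k N (hηk k).1 (hηk k).2 hB hBc _ (hT0 k hk)) h3

end Knit

/-! ## §2 N05's leaf clauses on `zdGF3 (M_n ℂ) L β len`, `β ∈ [0, 1]` -/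

section Matrices

variable {n : Type} [Fintype n] [DecidableEq n]

/-- **N16 · THE β-ROOT FROM THE [B8] LEAF ON THE UNIV SUB-FAMILY OF `zdGF3 (M_n(ℂ)) L β len` AND N07's (H3ˢᵘᵖ)** (`d = 4`, `L ≥ 2`, `N ≥ 1`; `𝔸 = M_n(ℂ)` with the
`L²`-operator-norm C⋆-structure assembled in the statement; a length function `len ≥ 1` on its support with `len e_μ = 1`) — generation 0's `N16.OfLeaf.n16_of_leaf`
with `1 ↦ β`: §1 with (T4^ℤᵈ_print)_β REPLACED by `B8.Thm4Body c₁ B₁′` ∧ `B8.Prop3Body cP 4 L C₂ inp B₀β` on `fun i ↦ zdGF3 (M_n(ℂ)) L β len i.1` over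
`{i // i.Ω 0 = univ}` FOR ANY `β ∈ [0, 1]` (quantified after `∃ C`; what n05-a's `thm4Printed_zd3` ∕ `prop3Printed_zd3` deliver at the residual exponent, modulo
their sockets), the letters `0 < B₁′`, `5·4·L·B₀ ≤ B₁′`, the window at `c₁′`, `16·(5·4·L·B₀)·c₁′ ≤ 1`; Thm-4 output constants `B := 5·4·L·B₀`, `B_h := 5·4·L·B₀β`.
`N16.OfLeaf.thm4TorusAt_print_of_leaf {β} (0 ≤ β)` ∘ §1.  N16 ∕ NE3 NOT proved: the leaf clauses are node N05's theorems, (H3ˢᵘᵖ) is N07's. [folklore] -/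
theorem n16_holderMS_of_leaf [Nonempty n] {L N : ℕ} (hL : 2 ≤ L) (hN : 1 ≤ N) :
    letI : CStarAlgebra (Matrix n n ℂ) := {}
    ∃ r : ℝ, 0 < r ∧ ∀ ⦃g : ℝ⦄, 0 < g → ∃ C : ℝ, 0 ≤ C ∧
      ∀ (c₁ c₁' B₁' cP C₂ B₀β : ℝ) (inp : B8.B9Inputs) (len : Site 4 → ℝ), (∀ v : Site 4, 0 < len v → 1 ≤ len v) →
      (∀ (μ : Fin 4) (j : ℕ), len (j • e μ) = j) → 0 < B₁' → 5 * ((4 : ℕ) : ℝ) * L * inp.B₀ ≤ B₁' → 16 * (5 * ((4 : ℕ) : ℝ) * L * inp.B₀ * c₁') ≤ 1 →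
      (∀ α₀ α₁ : ℝ, 0 < α₀ → 0 < α₁ → α₀ + α₁ ≤ c₁' →
        α₀ + α₁ ≤ c₁ ∧ C0 4 * (2 * α₀) ≤ 1 / 3 ∧ 4 * α₀ ≤ c2' 4 L ∧ 16 * (B₁' * (α₀ + α₁)) ≤ 1 ∧
        Real.exp (4 * (800 * (((4 : ℕ) : ℝ) + 1) ^ 2 * (((4 : ℕ) : ℝ) + 4)) * α₀) *
            (1 + 8 * (131072 * (((4 : ℕ) : ℝ) + 1) ^ 2) * (B₁' * (α₀ + α₁))) ≤ 2 ∧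
        2 * (B₁' * (α₀ + α₁)) ≤ c3 4 L ∧ ((4 : ℕ) : ℝ) * L * α₁ ≤ 1 / 8 ∧ α₀ ≤ cP ∧ α₁ ≤ cP ∧ B₁' * (α₀ + α₁) ≤ cP ∧
        2 * (B₁' * (α₀ + α₁)) ^ 2 + 20 * ((4 : ℕ) : ℝ) * α₀ * (B₁' * (α₀ + α₁)) + 2 * C₂ * (B₁' * (α₀ + α₁)) ^ 2 ≤ α₀ + α₁) →
      ∀ ⦃b' c' : ℝ⦄, 0 ≤ b' → 0 ≤ c' →
      2 ^ 15 * ((4 : ℝ) + 1) ^ 2 * ((4 : ℝ) + 4) ^ 2 * (L : ℝ) ^ 2 * b' ≤ 1 →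
      23040 * (4 : ℝ) ^ 4 * (frameC 4 L + 4) ^ 3 * (c' + curConst 4 L * b' ^ 2) ≤ 1 →
      ∀ ⦃α : ℝ⦄, 0 < α → C0 4 * α ≤ 1 / 3 → 2 * α ≤ c2' 4 L → 11 * (4 : ℝ) ^ 2 * α ≤ 1 / 6 → α + 11 * (4 : ℝ) ^ 2 * α ≤ c₁' →
      b' + 226 * (8 * ((4 : ℝ) + 1) * ((4 : ℝ) + 4)) ^ 2 * b' ^ 2 < α → 4 * ((4 : ℝ) - 1) * (c' + curConst 4 L * b' ^ 2) < α →
      ∀ ⦃Mc : ℝ⦄, 0 ≤ Mc → (Mc + 1) * (b' + 226 * (8 * ((4 : ℝ) + 1) * ((4 : ℝ) + 4)) ^ 2 * b' ^ 2) ≤ 1 / 2 →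
      ∀ (𝒬 : ℕ → Set (Set (Site 4) × ℕ)), (∀ k, ∀ q ∈ 𝒬 k, q.2 ≤ k ∧ ∃ y : Site 4, ∀ z ∈ q.1, (l1 (z - y) : ℝ) ≤ Mc * (L : ℝ) ^ q.2) →
      ∀ ⦃C335 : ℝ⦄, 2 * (Mc + 1) * (b' + 226 * (8 * ((4 : ℝ) + 1) * ((4 : ℝ) + 4)) ^ 2 * b' ^ 2) + 2 * Mc * (2 * (c' + curConst 4 L * b' ^ 2)) +
        4 * Mc * (1 + 2 * Mc) * (b' + 226 * (8 * ((4 : ℝ) + 1) * ((4 : ℝ) + 4)) ^ 2 * b' ^ 2) ^ 2 < C335 →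
      ∀ ⦃ε s₁ b s₂ : ℝ⦄, 0 < ε → ε ≤ r → ε < α → 0 ≤ s₁ → s₁ ≤ r → 0 ≤ b → b ≤ ε / 2 →
      5 * ((4 : ℕ) : ℝ) * L * inp.B₀ * (α + 11 * (4 : ℝ) ^ 2 * α) ≤ s₁ →
      5 * ((4 : ℕ) : ℝ) * L * inp.B₀ * (α + 11 * (4 : ℝ) ^ 2 * α) +
          2 * (b' + 226 * (8 * ((4 : ℝ) + 1) * ((4 : ℝ) + 4)) ^ 2 * b' ^ 2) * s₁ ≤ s₁ →
      5 * ((4 : ℕ) : ℝ) * L * inp.B₀ * (α + 11 * (4 : ℝ) ^ 2 * α) + 16 * (b' + 226 * (8 * ((4 : ℝ) + 1) * ((4 : ℝ) + 4)) ^ 2 * b' ^ 2) *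
          (5 * ((4 : ℕ) : ℝ) * L * inp.B₀ * (α + 11 * (4 : ℝ) ^ 2 * α)) ≤ s₁ →
      5 * ((4 : ℕ) : ℝ) * L * B₀β * (α + 11 * (4 : ℝ) ^ 2 * α) + 10 * (b' + 226 * (8 * ((4 : ℝ) + 1) * ((4 : ℝ) + 4)) ^ 2 * b' ^ 2) *
          (5 * ((4 : ℕ) : ℝ) * L * inp.B₀ * (α + 11 * (4 : ℝ) ^ 2 * α)) ≤ s₂ →
      ∀ ⦃β : ℝ⦄, 0 ≤ β → β ≤ 1 →
      B8.Thm4Body c₁ B₁' (fun i : {i : ZdIdx 4 L // i.Ω 0 = Set.univ} => (zdGF3 (Matrix n n ℂ) L β len i.1).toGFData) →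
      B8.Prop3Body cP 4 (L : ℝ) C₂ inp B₀β (fun i : {i : ZdIdx 4 L // i.Ω 0 = Set.univ} => (zdGF3 (Matrix n n ℂ) L β len i.1).toGFData2) →
      ∀ {dom : _root_.Set (Site 4 → Fin 4 → (Matrix n n ℂ)ˣ)},
        LeafH3sup 4 L N ε b' c' dom →
        CovRootHolderMS 4 (sfClass 4 L N ε) L N b g C s₁ s₂ β dom := by
  letI : CStarAlgebra (Matrix n n ℂ) := {}
  obtain ⟨r, hr0, hr⟩ := n16_holderMS_of_thm4Zd_printMS (n := n) hL hN
  refine ⟨r, hr0, fun g hg => ?_⟩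
  obtain ⟨C, hC0, hC⟩ := hr hg
  refine ⟨C, hC0, fun c₁ c₁' B₁' cP C₂ B₀β inp len hlen hlen1 hB₁' hBB h16 hwin b' c' hb' hc' hRb hcF α hα hA3 hA2 hAs hAc hb'α hc'α Mc hMc
    hMcα 𝒬 h𝒬 C335 hC335 ε s₁ b s₂ hε hεr hεα hs₁ hs₁r hb hbh hss hgrad hℓ hhol β hβ0 hβ1 hT hP dom h3 => ?_⟩
  have hB0 : 0 ≤ 5 * ((4 : ℕ) : ℝ) * L * inp.B₀ := by have := inp.B₀_pos.le; positivity
  have hT4 := thm4TorusAt_printMS_of_leaf (d := 4) (by norm_num) hL hβ0 hlen hlen1 hB₁' hBB hwin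
    (fun k => Reg335Zd (((L : ℝ) ^ k)⁻¹) L (𝒬 k) C335) hT hP
  exact hC c₁' (5 * ((4 : ℕ) : ℝ) * L * inp.B₀) (5 * ((4 : ℕ) : ℝ) * L * B₀β) hB0 h16 hb' hc' hRb hcF hα hA3 hA2 hAs hAc hb'α hc'α hMc
    hMcα 𝒬 h𝒬 hC335 hε hεr hεα hs₁ hs₁r hb hbh hss hgrad hℓ hhol hβ0 hβ1 hT4 h3

/-! ## §3 N05's leaf of record SHAPE `B8LeafRS` on `zdGF3 (M_n ℂ) L β len`, `β ∈ [0, 1]` — the N05 → N16 edge at N05's residual exponent -/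

/-- **N16 · THE β-ROOT FROM NODE N05's LEAF OF RECORD ON `zdGF3 (M_n(ℂ)) L β len` OVER THE UNIV SUB-INDEX AND N07's (H3ˢᵘᵖ)** (`d = 4`, `L ≥ 2`, `N ≥ 1`,
ANY `β ∈ [0, 1]` — node N05's RESIDUAL Hölder exponent `𝔯.β`, printed «β ≦ β₀ < 1») — generation 0's `N16.OfLeafRS.n16_of_b8LeafRS` with `1 ↦ β`: `∃ r > 0, ∀ g > 0,
∃ C ≥ 0`, then for all `β ∈ [0,1]`, leaf parameters `C₂ B₁′ B₀′ B₁ B₂ c₁ inp B₀β`, carriers `loc lan cub toAxial`, a length function `len ≥ 1` on its support with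
`len e_μ = 1`, letters `0 < B₁′`, `5·4·L·B₀ ≤ B₁′`: the leaf `B8LeafRS 4 L C₂ B₁′ B₀′ B₁ B₂ c₁ inp B₀β loc (fun i ↦ zdGF3 (M_n ℂ) L β len i.1) lan cub toAxial` yields a
threshold `c₁′ > 0` with `16·(5·4·L·B₀)·c₁′ ≤ 1` such that §2's tail holds verbatim, ending in `LeafH3sup 4 L N ε b′ c′ dom → CovRootHolderMS 4 (sfClass 4 L N ε) L N b g C s₁ s₂
β dom`.  Only the leaf's `t4` and `p3` are read.  THE N05 → N16 EDGE WITH BOTH ENDS IN THEIR OWNERS' CURRENCIES AT THE PRINTED EXPONENT RANGE; at `β := 1` it is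
`n16_of_b8LeafRS` (`covRootHolder_one_iff`).  N16 ∕ NE3 NOT proved: the leaf is node N05's theorem, (H3ˢᵘᵖ) is N07's. [folklore] -/
theorem n16_holderMS_of_b8LeafRS [Nonempty n] {L N : ℕ} (hL : 2 ≤ L) (hN : 1 ≤ N) :
    letI : CStarAlgebra (Matrix n n ℂ) := {}
    ∃ r : ℝ, 0 < r ∧ ∀ ⦃g : ℝ⦄, 0 < g → ∃ C : ℝ, 0 ≤ C ∧
      ∀ {I₁ I₃ I₄ : Type} ⦃β : ℝ⦄, 0 ≤ β → β ≤ 1 → ∀ (C₂ B₁' B₀' B₁ B₂ c₁ : ℝ) (inp : B8.B9Inputs) (B₀β : ℝ) (loc : I₁ → B8.LocalData)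
        (lan : I₃ → B8.LandauData) (cub : I₄ → B8.CubeData) (len : Site 4 → ℝ)
        (toAxial : ∀ i : {i : ZdIdx 4 L // i.Ω 0 = Set.univ},
          (zdGF3 (Matrix n n ℂ) L β len i.1).Cfg → (zdGF3 (Matrix n n ℂ) L β len i.1).Pert → (zdGF3 (Matrix n n ℂ) L β len i.1).Pert),
      (∀ v : Site 4, 0 < len v → 1 ≤ len v) → (∀ (μ : Fin 4) (j : ℕ), len (j • e μ) = j) → 0 < B₁' → 5 * ((4 : ℕ) : ℝ) * L * inp.B₀ ≤ B₁' →
      B8LeafRS 4 (L : ℝ) C₂ B₁' B₀' B₁ B₂ c₁ inp B₀β loc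
        (fun i : {i : ZdIdx 4 L // i.Ω 0 = Set.univ} => zdGF3 (Matrix n n ℂ) L β len i.1) lan cub toAxial →
      ∃ c₁' : ℝ, 0 < c₁' ∧ 16 * (5 * ((4 : ℕ) : ℝ) * L * inp.B₀ * c₁') ≤ 1 ∧
      ∀ ⦃b' c' : ℝ⦄, 0 ≤ b' → 0 ≤ c' →
      2 ^ 15 * ((4 : ℝ) + 1) ^ 2 * ((4 : ℝ) + 4) ^ 2 * (L : ℝ) ^ 2 * b' ≤ 1 →
      23040 * (4 : ℝ) ^ 4 * (frameC 4 L + 4) ^ 3 * (c' + curConst 4 L * b' ^ 2) ≤ 1 →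
      ∀ ⦃α : ℝ⦄, 0 < α → C0 4 * α ≤ 1 / 3 → 2 * α ≤ c2' 4 L → 11 * (4 : ℝ) ^ 2 * α ≤ 1 / 6 → α + 11 * (4 : ℝ) ^ 2 * α ≤ c₁' →
      b' + 226 * (8 * ((4 : ℝ) + 1) * ((4 : ℝ) + 4)) ^ 2 * b' ^ 2 < α → 4 * ((4 : ℝ) - 1) * (c' + curConst 4 L * b' ^ 2) < α →
      ∀ ⦃Mc : ℝ⦄, 0 ≤ Mc → (Mc + 1) * (b' + 226 * (8 * ((4 : ℝ) + 1) * ((4 : ℝ) + 4)) ^ 2 * b' ^ 2) ≤ 1 / 2 →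
      ∀ (𝒬 : ℕ → Set (Set (Site 4) × ℕ)), (∀ k, ∀ q ∈ 𝒬 k, q.2 ≤ k ∧ ∃ y : Site 4, ∀ z ∈ q.1, (l1 (z - y) : ℝ) ≤ Mc * (L : ℝ) ^ q.2) →
      ∀ ⦃C335 : ℝ⦄, 2 * (Mc + 1) * (b' + 226 * (8 * ((4 : ℝ) + 1) * ((4 : ℝ) + 4)) ^ 2 * b' ^ 2) + 2 * Mc * (2 * (c' + curConst 4 L * b' ^ 2)) +
        4 * Mc * (1 + 2 * Mc) * (b' + 226 * (8 * ((4 : ℝ) + 1) * ((4 : ℝ) + 4)) ^ 2 * b' ^ 2) ^ 2 < C335 →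
      ∀ ⦃ε s₁ b s₂ : ℝ⦄, 0 < ε → ε ≤ r → ε < α → 0 ≤ s₁ → s₁ ≤ r → 0 ≤ b → b ≤ ε / 2 →
      5 * ((4 : ℕ) : ℝ) * L * inp.B₀ * (α + 11 * (4 : ℝ) ^ 2 * α) ≤ s₁ →
      5 * ((4 : ℕ) : ℝ) * L * inp.B₀ * (α + 11 * (4 : ℝ) ^ 2 * α) +
          2 * (b' + 226 * (8 * ((4 : ℝ) + 1) * ((4 : ℝ) + 4)) ^ 2 * b' ^ 2) * s₁ ≤ s₁ →
      5 * ((4 : ℕ) : ℝ) * L * inp.B₀ * (α + 11 * (4 : ℝ) ^ 2 * α) + 16 * (b' + 226 * (8 * ((4 : ℝ) + 1) * ((4 : ℝ) + 4)) ^ 2 * b' ^ 2) *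
          (5 * ((4 : ℕ) : ℝ) * L * inp.B₀ * (α + 11 * (4 : ℝ) ^ 2 * α)) ≤ s₁ →
      5 * ((4 : ℕ) : ℝ) * L * B₀β * (α + 11 * (4 : ℝ) ^ 2 * α) + 10 * (b' + 226 * (8 * ((4 : ℝ) + 1) * ((4 : ℝ) + 4)) ^ 2 * b' ^ 2) *
          (5 * ((4 : ℕ) : ℝ) * L * inp.B₀ * (α + 11 * (4 : ℝ) ^ 2 * α)) ≤ s₂ →
      ∀ {dom : _root_.Set (Site 4 → Fin 4 → (Matrix n n ℂ)ˣ)},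
        LeafH3sup 4 L N ε b' c' dom →
        CovRootHolderMS 4 (sfClass 4 L N ε) L N b g C s₁ s₂ β dom := by
  letI : CStarAlgebra (Matrix n n ℂ) := {}
  obtain ⟨r, hr0, hr⟩ := n16_holderMS_of_leaf (n := n) hL hN
  refine ⟨r, hr0, fun g hg => ?_⟩
  obtain ⟨C, hC0, hC⟩ := hr hg
  refine ⟨C, hC0, fun {I₁ I₃ I₄} β hβ0 hβ1 C₂ B₁' B₀' B₁ B₂ c₁ inp B₀β loc lan cub len toAxial hlen hlen1 hB₁' hBB leaf => ?_⟩
  -- the two thresholds of the leaf's `t4` ∕ `p3`, and the window threshold below them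
  obtain ⟨c₁t, hc₁t, hT⟩ := leaf.t4
  obtain ⟨cP, hcP, hP⟩ := leaf.p3
  obtain ⟨c₁', hc₁', hwin⟩ := exists_window_print (d := 4) (L := L) (by norm_num) hL C₂ hc₁t hcP hB₁'
  have hB0 : 0 ≤ 5 * ((4 : ℕ) : ℝ) * L * inp.B₀ := by have := inp.B₀_pos.le; positivity
  have h16 : 16 * (5 * ((4 : ℕ) : ℝ) * L * inp.B₀ * c₁') ≤ 1 := by
    obtain ⟨-, -, -, h, -⟩ := hwin (c₁' / 2) (c₁' / 2) (by linarith) (by linarith) (by linarith)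
    have h' : 16 * (B₁' * c₁') ≤ 1 := by rwa [add_halves] at h
    nlinarith [mul_le_mul_of_nonneg_right hBB hc₁'.le]
  refine ⟨c₁', hc₁', h16, fun b' c' hb' hc' hRb hcF α hα hA3 hA2 hAs hAc hb'α hc'α Mc hMc hMcα 𝒬 h𝒬 C335 hC335 ε s₁ b s₂ hε hεr hεα hs₁
    hs₁r hb hbh hss hgrad hℓ hhol dom h3 => ?_⟩
  exact hC c₁t c₁' B₁' cP C₂ B₀β inp len hlen hlen1 hB₁' hBB h16 hwin hb' hc' hRb hcF hα hA3 hA2 hAs hAc hb'α hc'α hMc hMcα 𝒬 h𝒬 hC335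
    hε hεr hεα hs₁ hs₁r hb hbh hss hgrad hℓ hhol hβ0 hβ1 hT hP h3

end Matrices

end

end Summit.QuantumFields.YangMills.BalabanUVNodes.N16HolderMSOfLeafTop
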